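import Summits.AtomisticToContinuum.HydrodynamicLimit.Theorems.OneFlightGossipEngineClampedTransferDockCubicChannelRate
import Summits.AtomisticToContinuum.HydrodynamicLimit.Theorems.LambertianContactSwapLambertianEulerTailsZero
import Literature.Barriers.AtomisticToContinuum.HighMomentumCutoff
import HarnessLib

/-!
# SEET — typing audit and the Gaussian-moment sufficient condition (stub `stub_seet`, line `Sketch`,
# crux `ClampedTransferDock`, stmt-AtomisticToContinuum-17615)

`SuperExponentialEnergyTails` (SEET) is the line's TRUE-law static input: for every horizon `t < T` and every rate
`c > 0`, `∃ K₀ ∀ K ≥ K₀ ∀ ε ∃ N₀ ∀ N ≥ N₀ ∀ s ≤ t : E[(N+1)⁻¹ Σᵢ ‖vᵢ(s)‖³ 1{‖vᵢ(s)‖ > K}] ≤ e^{-cK} + ε` under the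
local-Gibbs-started hard-sphere flow tied to a classical hs-Euler solution. It is conjecture-grade (Nachtergaele–Yau's
cut-off hypothesis II.1 in its weakest sufficient form) and is NOT proved here. This file records, sorry-free:

* the typing audit: the registered signature (landed verbatim as
  `ClampedTransferDockCubicRate.SuperExponentialEnergyTails`, the def consumed by the landed `stub_cubicChannelRate`)
  is, as a term, the skeleton's text (`Iff.rfl` below), and it implies the route's crux `EnergyCurrentTails`
  (stmt-9235) — `seet_imp_energyCurrentTails` (rate `1`, level with `e^{-K} ≤ ε/2`, slack `ε/2`);
* the quantifier order `∀ c ∃ K₀ ∀ K ≥ K₀ ∀ ε ∃ N₀`: `K₀` is chosen from the rate alone (the consumer's use at rate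
  `2c`, shifted level `K₁ - U`, arbitrary accuracy — `seet_shifted`);
* the Gaussian-moment sufficient condition (`GaussianMomentGivesSEET` of the idea sketch, PROVED):
  the catalogued open hypothesis `Literature.Barriers.AtomisticToContinuum.HighMomentumCutoff σ` for `σ ∈ (0, 1/2)`
  implies SEET with `σ₀ = 1/2`, `N₀ = 0` and no use of the slack — pointwise `‖v‖³ 1{‖v‖ > K} ≤ e^{-(c/2)K²} e^{c‖v‖²}`
  for `K ≥ max 1 (48/c³)` (`indicator_cube_le_exp_rate`), then `e^{-(c/2)K²} C ≤ e^{-c′K}` for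
  `K ≥ max (2(c′+1)/c) (C + 1)` (`lintegral_cubicTail_le_of_expMoment`, `seet_of_highMomentumCutoff`);
* the `s = 0` rung of SEET, UNCONDITIONALLY and `N`-uniformly (`seet_time_zero`, sanity: the statement is not refuted at
  the initial time): under the local Gibbs law the velocities are Maxwellian given the positions, the landed Gaussian
  moment bound `LambertianContactSwapLambertianEulerTailsZero.localGibbs_expVelocityMoment_le` (σ ≤ 1/2) and
  `Φ_N(0) = id` a.e. (`ae_mem_good_localGibbsLaw`) give `E[(N+1)⁻¹ Σᵢ ‖vᵢ(0)‖³ 1{‖vᵢ(0)‖ > K}] ≤ e^{-c′K}` for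
  `K ≥ K₀(c′, a₀, u₀, θ₀)`, every `N` and every flow family.

* corollary (one line, in the companion file `…ClampedTransferDockOfHighMomentumCutoff.lean` over the landed conditional closing
  `ClampedTransferDockSketch.clampedTransferDock_of_inputs`, p140743): the dock `ClampedTransferDock` follows from the catalogued
  Gaussian-moment hypothesis (all `σ < 1/2`), `BandCoherenceLDFamily` and the two transfer-clamp inputs (iii), (iv).

References: B. Nachtergaele, H.-T. Yau, Comm. Math. Phys. 243 (2003), §2.3 Assumption II.1 and §7.2.

prover-line-stmt-AtomisticToContinuum-17615-0 (stub worker `stub_seet`, wave 1; landed by the lead, cycle 2).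
-/

noncomputable section

namespace Summit.AtomisticToContinuum.HydrodynamicLimit.Theorems.ClampedTransferDockSeet

open scoped BigOperators ENNReal Classical
open MeasureTheory Set Filter
open Literature.MathematicalPhysics.KineticTheory Literature.Analysis.FluidPDE
open Literature.Barriers.AtomisticToContinuum (HighMomentumCutoff expVelocityMoment expVelocityMoment_eq)
open Summit.AtomisticToContinuum.HydrodynamicLimit.Theses.OneFlightGossipEngine (EnergyCurrentTails)
open Summit.AtomisticToContinuum.HydrodynamicLimit.Theorems.ClampedTransferDockCubicRate (SuperExponentialEnergyTails)

/-! ## §1 Typing audit: the landed signature is the skeleton's text -/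

/-- The landed registered signature `ClampedTransferDockCubicRate.SuperExponentialEnergyTails` is, as a term, the text
of `SuperExponentialEnergyTails` in the skeleton `Cruxes/ClampedTransferDock/Lines/Sketch.lean` §1 (v3) and in the idea
sketch `IdeatorOneSketchRev29.lean` §1. -/
example : SuperExponentialEnergyTails ↔
    ∀ (a₀ θ₀ : T3 → ℝ) (u₀ : T3 → V3), Continuous a₀ → Continuous θ₀ → Continuous u₀ → (∀ x, 0 < a₀ x) →
    (∀ x, 0 < θ₀ x) → ∃ σ₀ : ℝ, 0 < σ₀ ∧ ∀ σ : ℝ, 0 < σ → σ < σ₀ →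
    ∀ (T : ℝ) (ρ θ : ℝ → T3 → ℝ) (u : ℝ → T3 → V3), IsHardSphereEulerSolution σ T ρ u θ →
    ∀ Φ : (N : ℕ) → HardSphereFlow (Torus.geometry (Fin 3)) (hsDiameter σ N) (N + 1),
    TendstoHydroFieldsAt (fun N => localGibbsLaw σ a₀ u₀ θ₀ N (Φ N)) Φ ρ u θ 0 →
    ∀ t ∈ Set.Ico 0 T, ∀ c : ℝ, 0 < c → ∃ K₀ : ℝ, 0 < K₀ ∧ ∀ K : ℝ, K₀ ≤ K → ∀ ε : ℝ, 0 < ε →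
    ∃ N₀ : ℕ, ∀ N : ℕ, N₀ ≤ N → ∀ s ∈ Set.Icc 0 t,
      ∫⁻ z, ENNReal.ofReal (((N : ℝ) + 1)⁻¹ * ∑ i : Fin (N + 1),
          Set.indicator {v : V3 | K < ‖v‖} (fun v => ‖v‖ ^ 3) (((Φ N).flow s z i).2))
        ∂(localGibbsLaw σ a₀ u₀ θ₀ N (Φ N)) ≤ ENNReal.ofReal (Real.exp (-(c * K)) + ε) :=
  Iff.rfl

/-! ## §2 SEET implies the route's crux `EnergyCurrentTails` (stmt-9235) -/

/-- An elementary choice of level: for `ε > 0` there is `K ≥ K₀` with `e^{-K} ≤ ε / 2`. [folklore] -/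
theorem exists_level_exp_le (K₀ ε : ℝ) (hε : 0 < ε) : ∃ K : ℝ, K₀ ≤ K ∧ Real.exp (-K) ≤ ε / 2 := by
  -- adapted from `IdeatorOneRound1Rev29.exists_level_exp_le` (idea sketch of the line)
  refine ⟨max K₀ (-Real.log (ε / 2)), le_max_left _ _, ?_⟩
  have hε2 : 0 < ε / 2 := by positivity
  calc Real.exp (-max K₀ (-Real.log (ε / 2)))
      ≤ Real.exp (-(-Real.log (ε / 2))) := Real.exp_le_exp.mpr (neg_le_neg (le_max_right _ _))
    _ = ε / 2 := by rw [neg_neg, Real.exp_log hε2]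

/-- **SEET implies the route's crux ECT (`OneFlightGossipEngine.EnergyCurrentTails`, stmt-9235)**: take the rate
`c = 1`, a level `K ≥ K₀(1)` with `e^{-K} ≤ ε/2`, then the slack `ε/2` (same `σ₀`). -/
theorem seet_imp_energyCurrentTails : Summit.AtomisticToContinuum.HydrodynamicLimit.Theorems.ClampedTransferDockCubicRate.SuperExponentialEnergyTails → Summit.AtomisticToContinuum.HydrodynamicLimit.Theses.OneFlightGossipEngine.EnergyCurrentTails := by
  -- adapted from `IdeatorOneRound1Rev29.seet_imp_energyCurrentTails` (idea sketch of the line)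
  intro h a₀ θ₀ u₀ ha hθ hu ha0 hθ0
  obtain ⟨σ₀, hσ₀, H⟩ := h a₀ θ₀ u₀ ha hθ hu ha0 hθ0
  refine ⟨σ₀, hσ₀, fun σ hσ hσlt T ρ θ u hE Φ htie t ht ε hε => ?_⟩
  obtain ⟨K₀, -, HK⟩ := H σ hσ hσlt T ρ θ u hE Φ htie t ht 1 one_pos
  obtain ⟨K, hK₀K, hexpK⟩ := exists_level_exp_le K₀ ε hε
  obtain ⟨N₀, HN⟩ := HK K hK₀K (ε / 2) (by positivity)
  refine ⟨K, N₀, fun N hN s hs => (HN N hN s hs).trans (ENNReal.ofReal_le_ofReal ?_)⟩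
  have h1 : Real.exp (-(1 * K)) = Real.exp (-K) := by rw [one_mul]
  rw [h1]
  linarith

/-! ## §3 Quantifier order: `K₀` depends on the rate only, the accuracy is chosen after the level -/

/-- **The consumer's instance of SEET** (as used by the landed `stub_cubicChannelRate`): at rate `2c` and drift bound
`U ≥ 0` there is a band-top threshold `K₀ ≥ 2U` such that for every `K₁ ≥ K₀` and every accuracy `e > 0`, eventually in
`N` and uniformly in `s ≤ t`, the cubic tail above the SHIFTED level `K₁ - U` is at most `e^{-2c(K₁-U)} + e ≤ e^{-cK₁} + e`
— `K₀` is chosen before `e`, as the consumer needs. -/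
theorem seet_shifted (h : SuperExponentialEnergyTails) :
    ∀ (a₀ θ₀ : T3 → ℝ) (u₀ : T3 → V3), Continuous a₀ → Continuous θ₀ → Continuous u₀ → (∀ x, 0 < a₀ x) →
    (∀ x, 0 < θ₀ x) → ∃ σ₀ : ℝ, 0 < σ₀ ∧ ∀ σ : ℝ, 0 < σ → σ < σ₀ →
    ∀ (T : ℝ) (ρ θ : ℝ → T3 → ℝ) (u : ℝ → T3 → V3), IsHardSphereEulerSolution σ T ρ u θ →
    ∀ Φ : (N : ℕ) → HardSphereFlow (Torus.geometry (Fin 3)) (hsDiameter σ N) (N + 1),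
    TendstoHydroFieldsAt (fun N => localGibbsLaw σ a₀ u₀ θ₀ N (Φ N)) Φ ρ u θ 0 →
    ∀ t ∈ Set.Ico 0 T, ∀ c U : ℝ, 0 < c → 0 ≤ U → ∃ K₀ : ℝ, 2 * U ≤ K₀ ∧ ∀ K₁ : ℝ, K₀ ≤ K₁ → ∀ e : ℝ, 0 < e →
    ∃ N₀ : ℕ, ∀ N : ℕ, N₀ ≤ N → ∀ s ∈ Set.Icc 0 t,
      ∫⁻ z, ENNReal.ofReal (((N : ℝ) + 1)⁻¹ * ∑ i : Fin (N + 1),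
          Set.indicator {v : V3 | K₁ - U < ‖v‖} (fun v => ‖v‖ ^ 3) (((Φ N).flow s z i).2))
        ∂(localGibbsLaw σ a₀ u₀ θ₀ N (Φ N)) ≤ ENNReal.ofReal (Real.exp (-(c * K₁)) + e) := by
  intro a₀ θ₀ u₀ ha hθ hu ha0 hθ0
  obtain ⟨σ₀, hσ₀, H⟩ := h a₀ θ₀ u₀ ha hθ hu ha0 hθ0
  refine ⟨σ₀, hσ₀, fun σ hσ hσlt T ρ θ u hE Φ htie t ht c U hc hU => ?_⟩
  obtain ⟨K₀, hK₀, HK⟩ := H σ hσ hσlt T ρ θ u hE Φ htie t ht (2 * c) (by positivity)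
  refine ⟨max K₀ (2 * U) + U, by linarith [le_max_right K₀ (2 * U)], fun K₁ hK₁ e he => ?_⟩
  have hK₁U : K₀ ≤ K₁ - U := by linarith [le_max_left K₀ (2 * U)]
  have h2U : 2 * U ≤ K₁ := by linarith [le_max_right K₀ (2 * U)]
  obtain ⟨N₀, HN⟩ := HK (K₁ - U) hK₁U e he
  refine ⟨N₀, fun N hN s hs => (HN N hN s hs).trans (ENNReal.ofReal_le_ofReal ?_)⟩
  have hX : Real.exp (-(2 * c * (K₁ - U))) ≤ Real.exp (-(c * K₁)) := Real.exp_le_exp.2 (by nlinarith)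
  linarith

/-! ## §4 The Gaussian-moment sufficient condition: `HighMomentumCutoff σ` (σ < 1/2) implies SEET -/

/-- Gaussian domination of the cube at half rate: for `c > 0` and `r > max 1 (48/c³)`, `r³ ≤ exp((c/2) r²)`
(from `x³/6 ≤ eˣ` at `x = (c/2) r²`, i.e. `c³ r⁶ / 48 ≤ e^{(c/2)r²}`, and `r⁴ ≤ r⁶` for `r ≥ 1`). [folklore] -/
theorem cube_le_exp_half_sq {c r : ℝ} (hc : 0 < c) (hr : max 1 (48 / c ^ 3) < r) :
    r ^ 3 ≤ Real.exp (c / 2 * r ^ 2) := by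
  -- adapted from `KineticWindowGronwallInheritedInputs.cube_le_mul_exp_sq_of_lt` (δ = 1, rate c/2)
  have h1 : 1 < r := lt_of_le_of_lt (le_max_left _ _) hr
  have h2 : 48 / c ^ 3 < r := lt_of_le_of_lt (le_max_right _ _) hr
  have hc3 : 0 < c ^ 3 := by positivity
  have hkey : 48 < c ^ 3 * r := by
    rw [div_lt_iff₀ hc3] at h2
    linarith
  have hexp : (c / 2 * r ^ 2) ^ 3 / 6 ≤ Real.exp (c / 2 * r ^ 2) := by
    have h := Real.pow_div_factorial_le_exp (x := c / 2 * r ^ 2) (by positivity) 3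
    simpa [Nat.factorial] using h
  have hr46 : r ^ 4 ≤ r ^ 6 := pow_le_pow_right₀ h1.le (by norm_num)
  calc r ^ 3 = 1 * r ^ 3 := (one_mul _).symm
    _ ≤ (c ^ 3 * r / 48) * r ^ 3 := by gcongr; linarith
    _ = c ^ 3 / 48 * r ^ 4 := by ring
    _ ≤ c ^ 3 / 48 * r ^ 6 := by gcongr
    _ = (c / 2 * r ^ 2) ^ 3 / 6 := by ring
    _ ≤ Real.exp (c / 2 * r ^ 2) := hexp

/-- **The cubic tail functional at a RATE**: for `c > 0` and `K ≥ max 1 (48/c³)`, pointwise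
`‖v‖³ 1{‖v‖ > K} ≤ e^{-(c/2)K²} · e^{c‖v‖²}` (the Gaussian moment dominates every exponential rate in the level). [folklore] -/
theorem indicator_cube_le_exp_rate {c K : ℝ} (hc : 0 < c) (hK : max 1 (48 / c ^ 3) ≤ K) (v : V3) :
    Set.indicator {w : V3 | K < ‖w‖} (fun w => ‖w‖ ^ 3) v ≤
      Real.exp (-(c / 2 * K ^ 2)) * Real.exp (c * ‖v‖ ^ 2) := by
  by_cases hv : K < ‖v‖
  · rw [Set.indicator_of_mem (show v ∈ {w : V3 | K < ‖w‖} from hv)]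
    have hK1 : 1 ≤ K := (le_max_left _ _).trans hK
    have hsq : K ^ 2 ≤ ‖v‖ ^ 2 := pow_le_pow_left₀ (zero_le_one.trans hK1) hv.le 2
    have hcsq := mul_le_mul_of_nonneg_left hsq hc.le
    calc ‖v‖ ^ 3 ≤ Real.exp (c / 2 * ‖v‖ ^ 2) := cube_le_exp_half_sq hc (lt_of_le_of_lt hK hv)
      _ ≤ Real.exp (-(c / 2 * K ^ 2) + c * ‖v‖ ^ 2) := Real.exp_le_exp.2 (by linarith)
      _ = Real.exp (-(c / 2 * K ^ 2)) * Real.exp (c * ‖v‖ ^ 2) := Real.exp_add _ _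
  · rw [Set.indicator_of_notMem (show v ∉ {w : V3 | K < ‖w‖} from hv)]
    positivity

/-- The rate bookkeeping: for `K ≥ max (2(c′+1)/c) (C+1)`, `e^{-(c/2)K²} · C ≤ e^{-c′K}`
(`(c/2)K² - c′K ≥ K` and `C ≤ K - 1 ≤ e^K`). [folklore] -/
theorem exp_half_sq_mul_le_exp_rate {c c' C K : ℝ} (hc : 0 < c) (hc' : 0 < c') (hKc : 2 * (c' + 1) / c ≤ K)
    (hKC : C + 1 ≤ K) : Real.exp (-(c / 2 * K ^ 2)) * C ≤ Real.exp (-(c' * K)) := by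
  have hK0 : 0 ≤ K := by
    have : 0 ≤ 2 * (c' + 1) / c := by positivity
    linarith
  have hcK : c' + 1 ≤ c / 2 * K := by
    rw [div_le_iff₀ hc] at hKc
    nlinarith
  have h1 : K ≤ c / 2 * K ^ 2 - c' * K := by nlinarith
  have h2 : C ≤ Real.exp (c / 2 * K ^ 2 - c' * K) := by
    have := Real.add_one_le_exp K
    linarith [Real.exp_le_exp.2 h1]
  calc Real.exp (-(c / 2 * K ^ 2)) * C ≤ Real.exp (-(c / 2 * K ^ 2)) * Real.exp (c / 2 * K ^ 2 - c' * K) :=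
        mul_le_mul_of_nonneg_left h2 (Real.exp_pos _).le
    _ = Real.exp (-(c' * K)) := by rw [← Real.exp_add]; ring_nf

/-- **From a Gaussian velocity moment to the cubic tail at a rate** (pointwise domination + linearity of the lower
integral, no Chebyshev): if `∫ (N+1)⁻¹ ∑ᵢ exp(c ‖vᵢ(F z)‖²) dμ ≤ C < ∞` then for every rate `c′ > 0` and every level
`K ≥ max (max 1 (48/c³)) (max (2(c′+1)/c) (C+1))`, `∫ (N+1)⁻¹ ∑ᵢ ‖vᵢ(F z)‖³ 1{‖vᵢ(F z)‖ > K} dμ ≤ e^{-c′K}`. [folklore] -/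
theorem lintegral_cubicTail_le_of_expMoment {N : ℕ} (μ : Measure (Config (N + 1) (Fin 3) T3))
    (F : Config (N + 1) (Fin 3) T3 → Config (N + 1) (Fin 3) T3) {c c' K : ℝ} {C : ℝ≥0∞} (hc : 0 < c)
    (hc' : 0 < c') (hC : C < ∞) (hb : ∫⁻ z, expVelocityMoment c (F z) ∂μ ≤ C)
    (hK : max (max 1 (48 / c ^ 3)) (max (2 * (c' + 1) / c) (C.toReal + 1)) ≤ K) :
    ∫⁻ z, ENNReal.ofReal (((N : ℝ) + 1)⁻¹ * ∑ i : Fin (N + 1),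
        Set.indicator {v : V3 | K < ‖v‖} (fun v => ‖v‖ ^ 3) ((F z i).2)) ∂μ ≤
      ENNReal.ofReal (Real.exp (-(c' * K))) := by
  -- adapted from `KineticWindowGronwallInheritedInputs.energyCurrentTails_of_gaussianTails` (HMC ⇒ ECT, rate-free)
  have hK48 : max 1 (48 / c ^ 3) ≤ K := (le_max_left _ _).trans hK
  have hKc : 2 * (c' + 1) / c ≤ K := ((le_max_left _ _).trans (le_max_right _ _)).trans hK
  have hKC : C.toReal + 1 ≤ K := ((le_max_right _ _).trans (le_max_right _ _)).trans hK
  have hrate : Real.exp (-(c / 2 * K ^ 2)) * C.toReal ≤ Real.exp (-(c' * K)) :=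
    exp_half_sq_mul_le_exp_rate hc hc' hKc hKC
  have hpt : ∀ z : Config (N + 1) (Fin 3) T3,
      ENNReal.ofReal (((N : ℝ) + 1)⁻¹ * ∑ i : Fin (N + 1),
        Set.indicator {v : V3 | K < ‖v‖} (fun v => ‖v‖ ^ 3) ((F z i).2)) ≤
      ENNReal.ofReal (Real.exp (-(c / 2 * K ^ 2))) * expVelocityMoment c (F z) := by
    intro z
    rw [expVelocityMoment_eq, ← ENNReal.ofReal_mul (Real.exp_pos _).le]
    refine ENNReal.ofReal_le_ofReal ?_
    calc ((N : ℝ) + 1)⁻¹ * ∑ i : Fin (N + 1), Set.indicator {v : V3 | K < ‖v‖} (fun v => ‖v‖ ^ 3) ((F z i).2)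
        ≤ ((N : ℝ) + 1)⁻¹ * ∑ i : Fin (N + 1), Real.exp (-(c / 2 * K ^ 2)) * Real.exp (c * ‖(F z i).2‖ ^ 2) :=
          mul_le_mul_of_nonneg_left
            (Finset.sum_le_sum fun i _ => indicator_cube_le_exp_rate hc hK48 _) (by positivity)
      _ = Real.exp (-(c / 2 * K ^ 2)) * (((N + 1 : ℕ) : ℝ)⁻¹ * ∑ i : Fin (N + 1),
            Real.exp (c * ‖(F z i).2‖ ^ 2)) := by
          rw [← Finset.mul_sum]
          push_cast
          ring
  calc ∫⁻ z, ENNReal.ofReal (((N : ℝ) + 1)⁻¹ * ∑ i : Fin (N + 1),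
          Set.indicator {v : V3 | K < ‖v‖} (fun v => ‖v‖ ^ 3) ((F z i).2)) ∂μ
      ≤ ∫⁻ z, ENNReal.ofReal (Real.exp (-(c / 2 * K ^ 2))) * expVelocityMoment c (F z) ∂μ := lintegral_mono (hpt ·)
    _ = ENNReal.ofReal (Real.exp (-(c / 2 * K ^ 2))) * ∫⁻ z, expVelocityMoment c (F z) ∂μ :=
        lintegral_const_mul' _ _ ENNReal.ofReal_ne_top
    _ ≤ ENNReal.ofReal (Real.exp (-(c / 2 * K ^ 2))) * C := mul_le_mul' le_rfl hb
    _ = ENNReal.ofReal (Real.exp (-(c / 2 * K ^ 2))) * ENNReal.ofReal C.toReal := by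
        rw [ENNReal.ofReal_toReal hC.ne]
    _ = ENNReal.ofReal (Real.exp (-(c / 2 * K ^ 2)) * C.toReal) :=
        (ENNReal.ofReal_mul (Real.exp_pos _).le).symm
    _ ≤ ENNReal.ofReal (Real.exp (-(c' * K))) := ENNReal.ofReal_le_ofReal hrate

/-- **`GaussianMomentGivesSEET` (the idea sketch's typed implication), PROVED: Nachtergaele–Yau's Gaussian velocity
moment along the true evolution — the catalogued open hypothesis `HighMomentumCutoff σ` — for every `σ ∈ (0, 1/2)`
implies SEET** (with `σ₀ = 1/2`, `N₀ = 0`, the slack unused). At `(t, c′)` apply `HighMomentumCutoff σ` with horizon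
`t + 1 > 0` to get `c > 0`, `C < ∞` with `∫ (N+1)⁻¹ ∑ᵢ exp(c ‖vᵢ(Φ_N(s) z)‖²) dλ^N ≤ C` for all `N`, `s ∈ [0, t+1]`; put
`K₀ = max (max 1 (48/c³)) (max (2(c′+1)/c) (C+1))` and use `lintegral_cubicTail_le_of_expMoment`. The Euler solution
and the `t = 0` law of large numbers are not used. [cite: NachtergaeleYau2003, §2.3 Assumption II.1 and §7.2] -/
theorem seet_of_highMomentumCutoff : (∀ σ : ℝ, 0 < σ → σ < 1 / 2 → Literature.Barriers.AtomisticToContinuum.HighMomentumCutoff σ) → Summit.AtomisticToContinuum.HydrodynamicLimit.Theorems.ClampedTransferDockCubicRate.SuperExponentialEnergyTails := by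
  intro h a₀ θ₀ u₀ ha hθ hu ha0 hθ0
  refine ⟨1 / 2, one_half_pos, fun σ hσ hσh T ρ θ u _hE Φ _hT0 t ht c' hc' => ?_⟩
  obtain ⟨c, hc, C, hC, hb⟩ := h σ hσ hσh a₀ θ₀ u₀ ha hθ hu ha0 hθ0 (t + 1) (by linarith [ht.1]) Φ
  refine ⟨max (max 1 (48 / c ^ 3)) (max (2 * (c' + 1) / c) (C.toReal + 1)),
    lt_of_lt_of_le one_pos ((le_max_left _ _).trans (le_max_left _ _)), fun K hK ε hε => ⟨0, fun N _ s hs => ?_⟩⟩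
  have hsT : s ∈ Set.Icc 0 (t + 1) := ⟨hs.1, hs.2.trans (by linarith)⟩
  exact (lintegral_cubicTail_le_of_expMoment (localGibbsLaw σ a₀ u₀ θ₀ N (Φ N)) ((Φ N).flow s) hc hc' hC
    (hb N s hsT) hK).trans (ENNReal.ofReal_le_ofReal (by linarith))

/-! ## §5 Sanity: the `s = 0` rung of SEET holds unconditionally, uniformly in `N` -/

/-- **SEET at the initial time, unconditionally** (refuter-style sanity check: the statement is not violated at `s = 0`,
with no `N₀` and no slack): for continuous profiles `a₀, θ₀ > 0`, `u₀`, every `σ ≤ 1/2`, every flow family and every rate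
`c′ > 0` there is `K₀ > 0` with `E_{λ^N}[(N+1)⁻¹ Σᵢ ‖vᵢ(Φ_N(0) z)‖³ 1{‖vᵢ(Φ_N(0) z)‖ > K}] ≤ e^{-c′K}` for all `K ≥ K₀` and
all `N` — the velocities are Maxwellian given the positions (landed Gaussian moment bound
`localGibbs_expVelocityMoment_le`) and `Φ_N(0) = id` almost surely (`ae_mem_good_localGibbsLaw`). [folklore] -/
theorem seet_time_zero {a₀ θ₀ : T3 → ℝ} {u₀ : T3 → V3} (ha : Continuous a₀) (hθ : Continuous θ₀)
    (hu : Continuous u₀) (ha0 : ∀ x, 0 < a₀ x) (hθ0 : ∀ x, 0 < θ₀ x) {σ : ℝ} (hσ : σ ≤ 1 / 2)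
    (Φ : (N : ℕ) → HardSphereFlow (Torus.geometry (Fin 3)) (hsDiameter σ N) (N + 1)) {c' : ℝ} (hc' : 0 < c') :
    ∃ K₀ : ℝ, 0 < K₀ ∧ ∀ K : ℝ, K₀ ≤ K → ∀ N : ℕ,
      ∫⁻ z, ENNReal.ofReal (((N : ℝ) + 1)⁻¹ * ∑ i : Fin (N + 1),
          Set.indicator {v : V3 | K < ‖v‖} (fun v => ‖v‖ ^ 3) (((Φ N).flow 0 z i).2))
        ∂(localGibbsLaw σ a₀ u₀ θ₀ N (Φ N)) ≤ ENNReal.ofReal (Real.exp (-(c' * K))) := by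
  obtain ⟨c, hc, C, hC, hb⟩ :=
    LambertianContactSwapLambertianEulerTailsZero.localGibbs_expVelocityMoment_le ha hθ hu ha0 hθ0 hσ
  refine ⟨max (max 1 (48 / c ^ 3)) (max (2 * (c' + 1) / c) (C.toReal + 1)),
    lt_of_lt_of_le one_pos ((le_max_left _ _).trans (le_max_left _ _)), fun K hK N => ?_⟩
  have hb0 : ∫⁻ z, expVelocityMoment c ((Φ N).flow 0 z) ∂(localGibbsLaw σ a₀ u₀ θ₀ N (Φ N)) ≤ C := by
    have hae : (fun z => expVelocityMoment c ((Φ N).flow 0 z)) =ᵐ[localGibbsLaw σ a₀ u₀ θ₀ N (Φ N)]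
        fun z => expVelocityMoment c z := by
      filter_upwards [ae_mem_good_localGibbsLaw σ a₀ u₀ θ₀ N (Φ N)] with z hz
      rw [(Φ N).flow_zero z hz]
    rw [lintegral_congr_ae hae]
    exact hb N (Φ N)
  exact lintegral_cubicTail_le_of_expMoment (localGibbsLaw σ a₀ u₀ θ₀ N (Φ N)) ((Φ N).flow 0) hc hc' hC hb0 hK

end Summit.AtomisticToContinuum.HydrodynamicLimit.Theorems.ClampedTransferDockSeet

end
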